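import Summits.HodgeConjecture.CorCM.TwoGroupUniqueInvolution
import Mathlib.GroupTheory.Complement
import HarnessLib

/-!
# `2`-groups whose elements of order `4` all square to one central involution `c`: splitting off the other involutions

COR-CM (cell `pub-hodgecm2`), binder seat b04 (gen 34), count-neutral own lane «Galois-CM-type classification».  KERNEL ONLY,
Mathlib only (plus gen 34's `CorCM/TwoGroupUniqueInvolution`): theorems; no definition, no named fact, no `sorry`.

THE REDUCTION OF THE `2`-GROUP CLASSIFICATION TO «ORDER-`4` ELEMENTS SQUARE TO `c`».  Let `G` be a finite `2`-group with a central
involution `c` and suppose (H2) every element of order dividing `4` squares into `{1, c}` (`y⁴ = 1 ⟹ y² ∈ {1, c}`).  Let `E` be a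
complement of `⟨c⟩` among the central involutions (`E` central of exponent `2`, `c ∉ E`, every central involution in `E ∪ cE`;
such `E` exists: `CorCM/CentralInvolutionComplement`) — when ALL involutions of `G` are central (gen 32/33: automatic for GOOD Galois CM fields of degree `≥ 52`)
this is a complement of `⟨c⟩` in `Ω₁(G)`.  Then `G/E` has a UNIQUE involution (an involution `yE` has `y² ∈ E`, so `y⁴ = 1`, so
`y² ∈ {1, c} ∩ E = 1`, so `y` is a central involution, `y ∈ E ∪ cE`, `yE = cE`), hence `G/E` is cyclic or generalised quaternion
(`UniqueInvolution.isCyclic_or_nonempty_mulEquiv_quaternionGroup`, gen 34), and (H2) lets one LIFT generators with their relations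
intact, producing a COMPLEMENT `H` of `E` containing `c`: **`G = H × E` (internal direct product, `E` central elementary abelian),
`H ≅ G/E` cyclic or generalised quaternion, `c ∈ H`.**  Consequence for the classification (A7-JUNCTION gen-34): under (H2) a GOOD
pair `(G, c)` is `(C_{2^k} or Q_{2^k}) × C₂^e` with `c` in the first factor, and the abelian classification (gens 15–16) resp. gen
30's `× C₂²` theorem leave exactly `e ≤ 1` — the conjectured list `C`, `Q`, `C × C₂`, `Q × C₂`.  What remains of the `2`-group
classification is the single statement «GOOD ⟹ (H2)»: an element of order `4` whose square is a central involution `t ≠ c` should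
make the field BAD (true in the index-two world: `C₄ ⋊ C_{2^a}`, `Q × C₄`, … by gens 30/34).

* (`CorCM/CentralInvolutionComplement.exists_complement_avoiding`, gen 34 — a complement `E` of `⟨c⟩` among the central
  involutions always exists.)
* `quotient_involution_eq` — under (H2) and `E` as above, `G/E` has at most one involution.
* **`exists_isComplement'_of_pow_four`** — THE SPLITTING: `|G| = 2^n` ⟹ `∃ H ≤ G` with `H.IsComplement' E`, `c ∈ H`, and
  `IsCyclic H ∨ (3 ≤ k ∧ Nonempty (H ≃* QuaternionGroup (2^(k-2))))`, `2^k = |G/E| = |H|`.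

## References

* [Rotman1995] J. J. Rotman, *An Introduction to the Theory of Groups*, 4th ed., GTM 148, Springer 1995, Thm. 5.46.
-/

namespace Summit.HodgeConjecture.CorCM.GaloisModels.UniqueInvolution

variable {G : Type*} [Group G]

/-! ## §1 The quotient by `E` has a unique involution -/

/-- Under (H2) «`y⁴ = 1 ⟹ y² ∈ {1, c}`», with `E` a `c`-avoiding subgroup of involutions such that every involution of `G` lies
in `E ∪ cE`: **any two involutions of `G/E` coincide** (they equal `cE`). [folklore] -/
theorem quotient_involution_eq {c : G} (hcc : c * c = 1) (E : Subgroup G) [E.Normal] (hcE : c ∉ E)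
    (hE : ∀ e ∈ E, e * e = 1) (hΩ : ∀ s : G, s * s = 1 → s ∈ E ∨ c * s ∈ E)
    (hsq : ∀ y : G, y ^ 4 = 1 → y * y = 1 ∨ y * y = c)
    (u v : G ⧸ E) (hu : u * u = 1) (hu1 : u ≠ 1) (hv : v * v = 1) (hv1 : v ≠ 1) : u = v := by
  have key : ∀ w : G ⧸ E, w * w = 1 → w ≠ 1 → w = (c : G ⧸ E) := by
    intro w hw hw1
    induction w using QuotientGroup.induction_on with
    | H y =>
      have hyy : y * y ∈ E := by
        rw [← QuotientGroup.eq_one_iff, QuotientGroup.mk_mul]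
        exact hw
      have hy4 : y ^ 4 = 1 := by
        rw [show (4 : ℕ) = 2 + 2 by norm_num, pow_add, pow_two]
        exact hE _ hyy
      rcases hsq y hy4 with h | h
      · rcases hΩ y h with h' | h'
        · exact absurd ((QuotientGroup.eq_one_iff y).2 h') hw1
        · have h1 : (c : G ⧸ E) * (y : G ⧸ E) = 1 := by
            rw [← QuotientGroup.mk_mul]
            exact (QuotientGroup.eq_one_iff _).2 h'
          have h2 : (c : G ⧸ E) * (c : G ⧸ E) = 1 := by
            rw [← QuotientGroup.mk_mul, hcc, QuotientGroup.mk_one]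
          calc (y : G ⧸ E) = (c : G ⧸ E) * ((c : G ⧸ E) * (y : G ⧸ E)) := by rw [← mul_assoc, h2, one_mul]
            _ = c := by rw [h1, mul_one]
      · exact absurd (h ▸ hyy) hcE
  rw [key u hu hu1, key v hv hv1]

/-! ## §2 The splitting -/

/-- **THE SPLITTING THEOREM.**  `|G| = 2^n`, `c` a central involution, `E` a central subgroup of exponent `2` with `c ∉ E` such that
every involution of `G` lies in `E ∪ cE`, and (H2) `y⁴ = 1 ⟹ y² ∈ {1, c}` for all `y`.  Then `E` has a COMPLEMENT `H ∋ c`: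
`G = H·E`, `H ∩ E = 1` (so `G ≅ H × E`), with `H ≅ G/E` CYCLIC or GENERALISED QUATERNION (`|H| = 2^k`).
[cite: Rotman1995, Thm. 5.46] -/
theorem exists_isComplement'_of_pow_four [Finite G] {n : ℕ} (hcard : Nat.card G = 2 ^ n) {c : G} (hcc : c * c = 1)
    (hccen : ∀ g : G, g * c = c * g) (E : Subgroup G) (hcE : c ∉ E)
    (hE : ∀ e ∈ E, e * e = 1 ∧ ∀ g : G, g * e = e * g)
    (hΩ : ∀ s : G, s * s = 1 → s ∈ E ∨ c * s ∈ E) (hsq : ∀ y : G, y ^ 4 = 1 → y * y = 1 ∨ y * y = c) :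
    ∃ (H : Subgroup G) (k : ℕ), H.IsComplement' E ∧ c ∈ H ∧ Nat.card H = 2 ^ k ∧
      (IsCyclic H ∨ (3 ≤ k ∧ Nonempty (H ≃* QuaternionGroup (2 ^ (k - 2))))) := by
  classical
  haveI hEn : E.Normal := ⟨fun e he g => by rw [(hE e he).2 g, mul_inv_cancel_right]; exact he⟩
  have hcen : ∀ e ∈ E, ∀ g : G, g * e = e * g := fun e he => (hE e he).2
  -- the quotient `Q = G/E` is a `2`-group with a unique involution
  obtain ⟨k, hk⟩ : ∃ k, Nat.card (G ⧸ E) = 2 ^ k := by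
    have hdvd : Nat.card (G ⧸ E) ∣ 2 ^ n := by
      rw [← hcard]
      exact Subgroup.card_quotient_dvd_card E
    obtain ⟨k, -, hk⟩ := (Nat.dvd_prime_pow Nat.prime_two).1 hdvd
    exact ⟨k, hk⟩
  have huniq := quotient_involution_eq hcc E hcE (fun e he => (hE e he).1) hΩ hsq
  -- it suffices to find a complement containing `c`
  suffices hH : ∃ H : Subgroup G, H.IsComplement' E ∧ c ∈ H by
    obtain ⟨H, hHE, hcH⟩ := hH
    let e : G ⧸ E ≃* H := hHE.QuotientMulEquiv
    have hHcard : Nat.card H = 2 ^ k := by rw [← hk]; exact (Nat.card_congr e.toEquiv).symm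
    refine ⟨H, k, hHE, hcH, hHcard, ?_⟩
    rcases isCyclic_or_nonempty_mulEquiv_quaternionGroup hk huniq with hcyc | ⟨hk3, ⟨f⟩⟩
    · haveI := hcyc
      exact Or.inl (isCyclic_of_surjective e e.surjective)
    · exact Or.inr ⟨hk3, ⟨e.symm.trans f⟩⟩
  -- tools: lifting facts
  have hmk : ∀ g : G, (QuotientGroup.mk g : G ⧸ E) = QuotientGroup.mk' E g := fun g => rfl
  have hdecomp : ∀ g h : G, (g : G ⧸ E) = (h : G ⧸ E) → ∃ e ∈ E, h * e = g := by
    intro g h hgh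
    rw [QuotientGroup.eq] at hgh
    exact ⟨(g⁻¹ * h)⁻¹, E.inv_mem hgh, by group⟩
  -- the `2^j`-th power of a lift is trivial as soon as its image is: squares control
  have hpow1 : ∀ (g : G) (j : ℕ), 1 ≤ j → g ^ (2 ^ j) ∈ E → g ^ (2 ^ j) = 1 := by
    intro g j hj hg
    have h4 : (g ^ (2 ^ (j - 1))) ^ 4 = 1 := by
      rw [← pow_mul, show 2 ^ (j - 1) * 4 = 2 ^ j + 2 ^ j by
        rw [show (4 : ℕ) = 2 * 2 by norm_num, ← mul_assoc, ← pow_succ, show j - 1 + 1 = j by omega]; ring, pow_add]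
      exact (hE _ hg).1
    have hsq' : g ^ (2 ^ (j - 1)) * g ^ (2 ^ (j - 1)) = g ^ (2 ^ j) := by
      rw [← pow_add, ← two_mul, ← pow_succ', show j - 1 + 1 = j by omega]
    rcases hsq _ h4 with h | h
    · rw [← hsq', h]
    · exact absurd (by rw [← h, hsq']; exact hg) hcE
  rcases isCyclic_or_exists_quaternion_relations hk huniq with hcyc | ⟨abar, hk3, habar, hrel⟩
  · -- CYCLIC QUOTIENT
    obtain ⟨gbar, hgbar⟩ := hcyc.exists_ofOrder_eq_natCard
    rw [hk] at hgbar
    rcases Nat.lt_or_ge k 2 with hk2 | hk2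
    · -- `k ≤ 1`: the complement is `⟨c⟩`
      refine ⟨Subgroup.zpowers c, Subgroup.isComplement'_of_disjoint_and_mul_eq_univ ?_ ?_, Subgroup.mem_zpowers c⟩
      · rw [Subgroup.disjoint_def]
        intro x hx hxE
        rw [Subgroup.mem_zpowers_iff] at hx
        obtain ⟨i, rfl⟩ := hx
        obtain ⟨j, hj | hj⟩ := Int.even_or_odd' i
        · rw [hj, zpow_mul, zpow_two, hcc, one_zpow]
        · exfalso
          apply hcE
          rw [hj, zpow_add, zpow_mul, zpow_two, hcc, one_zpow, one_mul, zpow_one] at hxE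
          exact hxE
      · refine Set.eq_univ_iff_forall.2 fun x => ?_
        -- every element of `Q` has order `≤ 2`
        have hx2 : (x : G ⧸ E) * (x : G ⧸ E) = 1 := by
          have hd : orderOf (x : G ⧸ E) ∣ 2 := by
            have h1 := orderOf_dvd_natCard (x : G ⧸ E)
            rw [hk] at h1
            have h2 : 2 ^ k ∣ 2 ^ 1 := Nat.pow_dvd_pow 2 (by omega)
            rw [pow_one] at h2
            exact h1.trans h2
          rw [← pow_two]
          exact orderOf_dvd_iff_pow_eq_one.1 hd
        by_cases hx1 : (x : G ⧸ E) = 1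
        · exact ⟨1, Subgroup.one_mem _, x, (QuotientGroup.eq_one_iff x).1 hx1, one_mul x⟩
        · have hc1' : (c : G ⧸ E) ≠ 1 := fun h => hcE ((QuotientGroup.eq_one_iff c).1 h)
          have hcc' : (c : G ⧸ E) * (c : G ⧸ E) = 1 := by rw [← QuotientGroup.mk_mul, hcc, QuotientGroup.mk_one]
          have hxc := huniq _ _ hx2 hx1 hcc' hc1'
          obtain ⟨e, he, hce⟩ := hdecomp x c hxc
          exact ⟨c, Subgroup.mem_zpowers c, e, he, hce⟩
    · -- `k ≥ 2`: the complement is `⟨g⟩` for any lift `g` of a generator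
      obtain ⟨g, rfl⟩ := QuotientGroup.mk_surjective gbar
      have hgk : g ^ (2 ^ k) = 1 := hpow1 g k (by omega) (by
        rw [← QuotientGroup.eq_one_iff, QuotientGroup.mk_pow, ← hgbar, pow_orderOf_eq_one])
      have hordg : orderOf g = 2 ^ k := by
        refine Nat.dvd_antisymm (orderOf_dvd_of_pow_eq_one hgk) ?_
        rw [← hgbar]
        exact orderOf_map_dvd (QuotientGroup.mk' E) g
      have hcg : c = g ^ (2 ^ (k - 1)) := by
        have h4 : (g ^ (2 ^ (k - 2))) ^ 4 = 1 := by
          rw [← pow_mul, show 2 ^ (k - 2) * 4 = 2 ^ k by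
            rw [show (4 : ℕ) = 2 ^ 2 by norm_num, ← pow_add, show k - 2 + 2 = k by omega], hgk]
        have hsq' : g ^ (2 ^ (k - 2)) * g ^ (2 ^ (k - 2)) = g ^ (2 ^ (k - 1)) := by
          rw [← pow_add, ← two_mul, ← pow_succ', show k - 2 + 1 = k - 1 by omega]
        rcases hsq _ h4 with h | h
        · exfalso
          rw [hsq'] at h
          have hd := orderOf_dvd_of_pow_eq_one h
          rw [hordg] at hd
          have := Nat.le_of_dvd (by positivity) hd
          have : 2 ^ (k - 1) < 2 ^ k := Nat.pow_lt_pow_right (by norm_num) (by omega)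
          omega
        · rw [← h, hsq']
      refine ⟨Subgroup.zpowers g, Subgroup.isComplement'_of_disjoint_and_mul_eq_univ ?_ ?_, ?_⟩
      · rw [Subgroup.disjoint_def]
        intro x hx hxE
        rw [Subgroup.mem_zpowers_iff] at hx
        obtain ⟨i, rfl⟩ := hx
        have h1 : (QuotientGroup.mk g : G ⧸ E) ^ i = 1 := by
          rw [← QuotientGroup.mk_zpow]
          exact (QuotientGroup.eq_one_iff _).2 hxE
        have hd : (orderOf (QuotientGroup.mk g : G ⧸ E) : ℤ) ∣ i := orderOf_dvd_iff_zpow_eq_one.2 h1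
        rw [hgbar, ← hordg] at hd
        exact orderOf_dvd_iff_zpow_eq_one.1 hd
      · refine Set.eq_univ_iff_forall.2 fun x => ?_
        have hx : (x : G ⧸ E) ∈ Subgroup.zpowers (QuotientGroup.mk g : G ⧸ E) := by
          have htop : Subgroup.zpowers (QuotientGroup.mk g : G ⧸ E) = ⊤ := by
            apply Subgroup.eq_top_of_card_eq
            rw [Nat.card_zpowers, hgbar, hk]
          rw [htop]
          exact Subgroup.mem_top _
        rw [Subgroup.mem_zpowers_iff] at hx
        obtain ⟨i, hi⟩ := hx
        rw [← QuotientGroup.mk_zpow] at hi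
        obtain ⟨e, he, hxe⟩ := hdecomp x (g ^ i) hi.symm
        exact ⟨g ^ i, Subgroup.zpow_mem _ (Subgroup.mem_zpowers g) i, e, he, hxe⟩
      · rw [hcg]
        exact Subgroup.pow_mem _ (Subgroup.mem_zpowers g) _
  · -- QUATERNION QUOTIENT (`k ≥ 3`)
    obtain ⟨a, rfl⟩ := QuotientGroup.mk_surjective abar
    have hak : a ^ (2 ^ (k - 1)) = 1 := hpow1 a (k - 1) (by omega) (by
      rw [← QuotientGroup.eq_one_iff, QuotientGroup.mk_pow, ← habar, pow_orderOf_eq_one])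
    have horda : orderOf a = 2 ^ (k - 1) := by
      refine Nat.dvd_antisymm (orderOf_dvd_of_pow_eq_one hak) ?_
      rw [← habar]
      exact orderOf_map_dvd (QuotientGroup.mk' E) a
    -- `a^(2^(k-2)) = c`
    have hac : a ^ (2 ^ (k - 2)) = c := by
      have h4 : (a ^ (2 ^ (k - 3))) ^ 4 = 1 := by
        rw [← pow_mul, show 2 ^ (k - 3) * 4 = 2 ^ (k - 1) by
          rw [show (4 : ℕ) = 2 ^ 2 by norm_num, ← pow_add, show k - 3 + 2 = k - 1 by omega], hak]
      have hsq' : a ^ (2 ^ (k - 3)) * a ^ (2 ^ (k - 3)) = a ^ (2 ^ (k - 2)) := by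
        rw [← pow_add, ← two_mul, ← pow_succ', show k - 3 + 1 = k - 2 by omega]
      rcases hsq _ h4 with h | h
      · exfalso
        rw [hsq'] at h
        have hd := orderOf_dvd_of_pow_eq_one h
        rw [horda] at hd
        have := Nat.le_of_dvd (by positivity) hd
        have : 2 ^ (k - 2) < 2 ^ (k - 1) := Nat.pow_lt_pow_right (by norm_num) (by omega)
        omega
      · rw [← hsq', h]
    -- an element outside `⟨ā⟩` and its lift `x`
    set A := Subgroup.zpowers (QuotientGroup.mk a : G ⧸ E) with hA
    have hAidx : A.index = 2 := by
      have h1 := A.index_mul_card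
      rw [hA, Nat.card_zpowers, habar, hk, show 2 ^ k = 2 * 2 ^ (k - 1) by
        rw [← pow_succ', show k - 1 + 1 = k by omega]] at h1
      exact Nat.eq_of_mul_eq_mul_right (by positivity) h1
    obtain ⟨xbar, hxbar⟩ : ∃ xbar : G ⧸ E, xbar ∉ A := by
      by_contra h
      push Not at h
      have htop : A = ⊤ := (Subgroup.eq_top_iff' A).2 h
      rw [htop, Subgroup.index_top] at hAidx
      norm_num at hAidx
    obtain ⟨x, rfl⟩ := QuotientGroup.mk_surjective xbar
    obtain ⟨hxa_bar, hxx_bar⟩ := hrel _ hxbar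
    -- lift the relations
    obtain ⟨e₀, he₀, hxa⟩ : ∃ e₀ ∈ E, a⁻¹ * e₀ = x * a * x⁻¹ := by
      refine hdecomp (x * a * x⁻¹) a⁻¹ ?_
      rw [QuotientGroup.mk_mul, QuotientGroup.mk_mul, QuotientGroup.mk_inv, QuotientGroup.mk_inv, hxa_bar]
    obtain ⟨e₁, he₁, hxx⟩ : ∃ e₁ ∈ E, c * e₁ = x * x := by
      refine hdecomp (x * x) c ?_
      rw [QuotientGroup.mk_mul, hxx_bar, ← hac, QuotientGroup.mk_pow]
    -- `x² = c`
    have hxx' : x * x = c := by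
      have h4 : x ^ 4 = 1 := by
        rw [show (4 : ℕ) = 2 + 2 by norm_num, pow_add, pow_two, ← hxx,
          show c * e₁ * (c * e₁) = (c * c) * (e₁ * e₁) by rw [mul_assoc, ← mul_assoc e₁ c, ← hcen e₁ he₁ c]; group,
          hcc, (hE e₁ he₁).1, one_mul]
      rcases hsq x h4 with h | h
      · exfalso
        apply hcE
        have : c = e₁⁻¹ := eq_inv_of_mul_eq_one_left (by rw [hxx, h])
        rw [this]
        exact E.inv_mem he₁
      · exact h
    -- `x a x⁻¹ = a⁻¹`
    have hxa' : x * a * x⁻¹ = a⁻¹ := by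
      have hsq2 : (x * a) * (x * a) = e₀ * c := by
        calc (x * a) * (x * a) = (x * a * x⁻¹) * (x * x) * a := by group
          _ = a⁻¹ * e₀ * c * a := by rw [← hxa, hxx']
          _ = a⁻¹ * (e₀ * (c * a)) := by group
          _ = e₀ * c := by
            rw [← hccen a, show a⁻¹ * (e₀ * (a * c)) = a⁻¹ * ((e₀ * a) * c) by group, ← hcen e₀ he₀ a]
            group
      have h4 : (x * a) ^ 4 = 1 := by
        rw [show (4 : ℕ) = 2 + 2 by norm_num, pow_add, pow_two, hsq2,
          show e₀ * c * (e₀ * c) = (e₀ * e₀) * (c * c) by rw [mul_assoc, ← mul_assoc c e₀, hcen e₀ he₀ c]; group,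
          (hE e₀ he₀).1, hcc, one_mul]
      rcases hsq _ h4 with h | h
      · exfalso
        apply hcE
        rw [hsq2] at h
        have : c = e₀⁻¹ := eq_inv_of_mul_eq_one_right h
        rw [this]
        exact E.inv_mem he₀
      · rw [hsq2, mul_eq_right] at h
        rw [← hxa, h, mul_one]
    -- the complement `H = ⟨a, x⟩ = {aⁱ, x aⁱ}`
    set H := Subgroup.closure ({a, x} : Set G) with hH
    have haH : a ∈ H := Subgroup.subset_closure (by simp)
    have hxH : x ∈ H := Subgroup.subset_closure (by simp)
    have hcz : c = a ^ ((2 ^ (k - 2) : ℕ) : ℤ) := by rw [zpow_natCast, hac]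
    have hxinv : x⁻¹ = x * c := by
      rw [← hxx']
      exact (eq_inv_of_mul_eq_one_left (by rw [show x * (x * x) * x = (x * x) * (x * x) by group, hxx', hcc])).symm
    -- normal form of the elements of `H`
    have hform : ∀ h ∈ H, ∃ i : ℤ, h = a ^ i ∨ h = x * a ^ i := by
      intro h hh
      induction hh using Subgroup.closure_induction with
      | mem y hy =>
        simp only [Set.mem_insert_iff, Set.mem_singleton_iff] at hy
        rcases hy with rfl | rfl
        · exact ⟨1, Or.inl (zpow_one _).symm⟩
        · exact ⟨0, Or.inr (by rw [zpow_zero, mul_one])⟩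
      | one => exact ⟨0, Or.inl (zpow_zero _).symm⟩
      | mul y z _ _ ihy ihz =>
        obtain ⟨i, hi⟩ := ihy
        obtain ⟨j, hj⟩ := ihz
        rcases hi with rfl | rfl <;> rcases hj with rfl | rfl
        · exact ⟨i + j, Or.inl (zpow_add a i j).symm⟩
        · refine ⟨-i + j, Or.inr ?_⟩
          rw [← mul_assoc, zpow_mul_eq_mul_zpow_inv_of_conj_eq_inv hxa' i, mul_assoc, ← zpow_neg, ← zpow_add]
        · exact ⟨i + j, Or.inr (by rw [mul_assoc, ← zpow_add])⟩
        · refine ⟨(2 ^ (k - 2) : ℕ) + (-i + j), Or.inl ?_⟩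
          rw [show x * a ^ i * (x * a ^ j) = x * (a ^ i * x) * a ^ j by group, zpow_mul_eq_mul_zpow_inv_of_conj_eq_inv hxa' i,
            show x * (x * (a ^ i)⁻¹) * a ^ j = (x * x) * ((a ^ i)⁻¹ * a ^ j) by group, hxx', hcz, ← zpow_neg, ← zpow_add,
            ← zpow_add]
      | inv y _ ih =>
        obtain ⟨i, hi⟩ := ih
        rcases hi with rfl | rfl
        · exact ⟨-i, Or.inl (zpow_neg a i).symm⟩
        · refine ⟨i + (2 ^ (k - 2) : ℕ), Or.inr ?_⟩
          rw [mul_inv_rev, hxinv, ← zpow_neg, show a ^ (-i) * (x * c) = (a ^ (-i) * x) * c by group,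
            zpow_mul_eq_mul_zpow_inv_of_conj_eq_inv hxa' (-i), ← zpow_neg, neg_neg, hcz, mul_assoc, ← zpow_add]
    -- membership of lifts in `A`
    have hmkzpow : ∀ i : ℤ, (QuotientGroup.mk (a ^ i) : G ⧸ E) = (QuotientGroup.mk a : G ⧸ E) ^ i := fun i =>
      QuotientGroup.mk_zpow E a i
    refine ⟨H, Subgroup.isComplement'_of_disjoint_and_mul_eq_univ ?_ ?_, ?_⟩
    · -- `H ∩ E = 1`
      rw [Subgroup.disjoint_def]
      intro h hh hhE
      obtain ⟨i, hi⟩ := hform h hh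
      rcases hi with rfl | rfl
      · have h1 : (QuotientGroup.mk a : G ⧸ E) ^ i = 1 := by
          rw [← hmkzpow]
          exact (QuotientGroup.eq_one_iff _).2 hhE
        have hd : (orderOf (QuotientGroup.mk a : G ⧸ E) : ℤ) ∣ i := orderOf_dvd_iff_zpow_eq_one.2 h1
        rw [habar, ← horda] at hd
        exact orderOf_dvd_iff_zpow_eq_one.1 hd
      · exfalso
        apply hxbar
        have h1 : (QuotientGroup.mk x : G ⧸ E) * (QuotientGroup.mk a : G ⧸ E) ^ i = 1 := by
          rw [← hmkzpow, ← QuotientGroup.mk_mul]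
          exact (QuotientGroup.eq_one_iff _).2 hhE
        rw [mul_eq_one_iff_eq_inv] at h1
        rw [h1]
        exact A.inv_mem (A.zpow_mem (Subgroup.mem_zpowers _) i)
    · -- `H E = G`
      refine Set.eq_univ_iff_forall.2 fun g => ?_
      by_cases hgA : (g : G ⧸ E) ∈ A
      · rw [hA, Subgroup.mem_zpowers_iff] at hgA
        obtain ⟨i, hi⟩ := hgA
        rw [← hmkzpow] at hi
        obtain ⟨e, he, hge⟩ := hdecomp g (a ^ i) hi.symm
        exact ⟨a ^ i, H.zpow_mem haH i, e, he, hge⟩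
      · have hmem : (QuotientGroup.mk x : G ⧸ E)⁻¹ * (g : G ⧸ E) ∈ A := by
          rw [Subgroup.mul_mem_iff_of_index_two hAidx, Subgroup.inv_mem_iff]
          exact ⟨fun h => absurd h hxbar, fun h => absurd h hgA⟩
        rw [hA, Subgroup.mem_zpowers_iff] at hmem
        obtain ⟨i, hi⟩ := hmem
        rw [← hmkzpow, eq_inv_mul_iff_mul_eq, ← QuotientGroup.mk_mul] at hi
        obtain ⟨e, he, hge⟩ := hdecomp g (x * a ^ i) hi.symm
        exact ⟨x * a ^ i, H.mul_mem hxH (H.zpow_mem haH i), e, he, hge⟩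
    · -- `c ∈ H`
      rw [← hac]
      exact H.pow_mem haH _

end Summit.HodgeConjecture.CorCM.GaloisModels.UniqueInvolution
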